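import Summits.CriticalPhenomena.PercolationContinuityZ3.Theorems.SahiMasterFamilyGHConjecture

/-!
# `(UC-hull)_4`: Sahi positivity on the normalised union-closed polytope at order four — an explicit degree-4 certificate

Unit `prim-masterthm-p4` (gen 16; crux anchor stmt-CriticalPhenomena-4575, helper work; memo
`run/shared/lean/prim/prim-masterthm/prim-masterthm-p4/P4-GEN16-REPORT.md` §1).  Companion of `…GHConjecture` (`UCHullNonneg k` = (UC-hull)_k,
`ucHullNonneg_three`; `GSystemNonneg k` = (GH)_k ⟺ Sahi's `C_k` on the principal-cap stratum) and `…PrincipalCapBetaSmall` (`phiSet_four`).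

Gen 15 (memo P4-GEN15-REPORT §8–§9, item (R2)) left `(UC-hull)_4` — the first order at which union-closure matters (the box point
`β_i = 1, β_ij = 0, β_ijk = 1` has `Φ_4 = −3`) — as numerically true but uncertified (two LP shapes "one atom × monomial" and "two atoms ×
monomial" were infeasible at degree 4).  Here it is PROVED by a twenty-term identity.  In defect variables `d_S = 1 − β_S` (`d_univ = 0`) the
fixed-point decomposition of the cycle form reads
`Φ_4 = (e_3 − e_4)(d_0,…,d_3) + Σ_{ij} d_ij (d_k + d_l − d_k d_l) + 2 Σ_i d_{[4]−i}(1 − d_i) − (d_01 d_23 + d_02 d_13 + d_03 d_12)`,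
and the three complementary products are charged half-and-half to their two sides using only the PAIRWISE-UNION inequalities
`d_kl ≤ d_k + d_l` (i.e. `β_k + β_l ≤ 1 + β_kl`, valid on the union-closed polytope since `{k} ∪ {l} = {k,l}`):
`d_ij d_kl ≤ ½ d_ij (d_k + d_l) + ½ (d_i + d_j) d_kl`, after which the budget of each pair `{i,j}` retains
`d_ij (½(d_k + d_l) − d_k d_l) = ½ d_ij (d_k(1 − d_l) + d_l(1 − d_k)) ≥ 0`.

* `phiSet_four_eq_cert` — the polynomial identity (given `β univ = 1`).
* **`phiSet_four_nonneg_of_pairUnion`** — `0 ≤ β ≤ 1`, `β univ = 1` and `β S + β T ≤ 1 + β (S ∪ T)` for all `S, T` imply `Φ_4(β) ≥ 0`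
  (no supermultiplicativity: this is the LINEAR union-closed relaxation `F^{UC}(4)`, strictly larger than `P_UC(4)`; only the six
  inequalities with `S, T` singletons are used).
* **`ucHullNonneg_four : GHConjecture.UCHullNonneg 4`** — every mixture of indicators of union-closed families `∋ univ` satisfies the
  pairwise-union inequalities.
HONEST FRAMING: `(UC-hull)_k` remains OPEN for `k ≥ 5` (numerics clean `k ≤ 10`); `(GH)_k` = PC-k is known for `k ≤ 7` and OPEN for `k ≥ 8`;
Sahi's `C_k`, Kahn's Conjecture 5 and the master theorem remain OPEN.  Axioms standard. [this work]
-/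

noncomputable section

open scoped Classical

namespace Summit.CriticalPhenomena.PercolationContinuityZ3.Theorems

namespace UCHullFour

open Finset
open Literature.Combinatorics.Sahi2008
open PrincipalCapBeta (phiSet)

/-- **The degree-4 certificate** (twenty products of the atoms `β_S`, `1 − β_S`, `1 + β_{kl} − β_k − β_l`, nonnegative rational
coefficients): for `β univ = 1`, `Φ_4(β)` equals their sum identically. [this work] -/
theorem phiSet_four_eq_cert (β : Finset (Fin 4) → ℝ) (htop : β univ = 1) :
    phiSet 4 β =
      (1 - β {1}) * (1 - β {2}) * (1 - β {3}) * (3 / 4 + β {0} / 4)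
      + (1 - β {0}) * (1 - β {2}) * (1 - β {3}) * (3 / 4 + β {1} / 4)
      + (1 - β {0}) * (1 - β {1}) * (1 - β {3}) * (3 / 4 + β {2} / 4)
      + (1 - β {0}) * (1 - β {1}) * (1 - β {2}) * (3 / 4 + β {3} / 4)
      + 2 * ((1 - β {1, 2, 3}) * β {0})
      + 2 * ((1 - β {0, 2, 3}) * β {1})
      + 2 * ((1 - β {0, 1, 3}) * β {2})
      + 2 * ((1 - β {0, 1, 2}) * β {3})
      + (1 / 2) * ((1 - β {0, 1}) * ((1 - β {2}) * β {3} + (1 - β {3}) * β {2}))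
      + (1 / 2) * ((1 - β {0, 1}) * (1 + β {2, 3} - β {2} - β {3}))
      + (1 / 2) * ((1 - β {0, 2}) * ((1 - β {1}) * β {3} + (1 - β {3}) * β {1}))
      + (1 / 2) * ((1 - β {0, 2}) * (1 + β {1, 3} - β {1} - β {3}))
      + (1 / 2) * ((1 - β {0, 3}) * ((1 - β {1}) * β {2} + (1 - β {2}) * β {1}))
      + (1 / 2) * ((1 - β {0, 3}) * (1 + β {1, 2} - β {1} - β {2}))
      + (1 / 2) * ((1 - β {1, 2}) * ((1 - β {0}) * β {3} + (1 - β {3}) * β {0}))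
      + (1 / 2) * ((1 - β {1, 2}) * (1 + β {0, 3} - β {0} - β {3}))
      + (1 / 2) * ((1 - β {1, 3}) * ((1 - β {0}) * β {2} + (1 - β {2}) * β {0}))
      + (1 / 2) * ((1 - β {1, 3}) * (1 + β {0, 2} - β {0} - β {2}))
      + (1 / 2) * ((1 - β {2, 3}) * ((1 - β {0}) * β {1} + (1 - β {1}) * β {0}))
      + (1 / 2) * ((1 - β {2, 3}) * (1 + β {0, 1} - β {0} - β {1})) := by
  rw [PrincipalCapBeta.phiSet_four, htop]
  ring

/-- **`F^{UC}(4)`: `Φ_4 ≥ 0` on the linear union-closed relaxation.**  If `0 ≤ β ≤ 1`, `β univ = 1` and the pairwise-union inequalities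
`β S + β T ≤ 1 + β (S ∪ T)` hold (only the six with `S, T` singletons are used), then `Φ_4(β) ≥ 0`.  No supermultiplicativity is
assumed. [this work] -/
theorem phiSet_four_nonneg_of_pairUnion (β : Finset (Fin 4) → ℝ) (h0 : ∀ B, 0 ≤ β B) (h1 : ∀ B, β B ≤ 1) (htop : β univ = 1)
    (hu : ∀ S T : Finset (Fin 4), β S + β T ≤ 1 + β (S ∪ T)) : 0 ≤ phiSet 4 β := by
  have c1 : ∀ B, 0 ≤ 1 - β B := fun B => sub_nonneg.2 (h1 B)
  have u01 : 0 ≤ 1 + β {0, 1} - β {0} - β {1} := by have := hu {0} {1}; simp at this; linarith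
  have u02 : 0 ≤ 1 + β {0, 2} - β {0} - β {2} := by have := hu {0} {2}; simp at this; linarith
  have u03 : 0 ≤ 1 + β {0, 3} - β {0} - β {3} := by have := hu {0} {3}; simp at this; linarith
  have u12 : 0 ≤ 1 + β {1, 2} - β {1} - β {2} := by have := hu {1} {2}; simp at this; linarith
  have u13 : 0 ≤ 1 + β {1, 3} - β {1} - β {3} := by have := hu {1} {3}; simp at this; linarith
  have u23 : 0 ≤ 1 + β {2, 3} - β {2} - β {3} := by have := hu {2} {3}; simp at this; linarith
  have t1_0 : 0 ≤ (1 - β {1}) * (1 - β {2}) * (1 - β {3}) * (3 / 4 + β {0} / 4) :=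
    mul_nonneg (mul_nonneg (mul_nonneg (c1 {1}) (c1 {2})) (c1 {3})) (by linarith [h0 {0}])
  have t1_1 : 0 ≤ (1 - β {0}) * (1 - β {2}) * (1 - β {3}) * (3 / 4 + β {1} / 4) :=
    mul_nonneg (mul_nonneg (mul_nonneg (c1 {0}) (c1 {2})) (c1 {3})) (by linarith [h0 {1}])
  have t1_2 : 0 ≤ (1 - β {0}) * (1 - β {1}) * (1 - β {3}) * (3 / 4 + β {2} / 4) :=
    mul_nonneg (mul_nonneg (mul_nonneg (c1 {0}) (c1 {1})) (c1 {3})) (by linarith [h0 {2}])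
  have t1_3 : 0 ≤ (1 - β {0}) * (1 - β {1}) * (1 - β {2}) * (3 / 4 + β {3} / 4) :=
    mul_nonneg (mul_nonneg (mul_nonneg (c1 {0}) (c1 {1})) (c1 {2})) (by linarith [h0 {3}])
  have t2_0 : 0 ≤ 2 * ((1 - β {1, 2, 3}) * β {0}) := mul_nonneg zero_le_two (mul_nonneg (c1 _) (h0 _))
  have t2_1 : 0 ≤ 2 * ((1 - β {0, 2, 3}) * β {1}) := mul_nonneg zero_le_two (mul_nonneg (c1 _) (h0 _))
  have t2_2 : 0 ≤ 2 * ((1 - β {0, 1, 3}) * β {2}) := mul_nonneg zero_le_two (mul_nonneg (c1 _) (h0 _))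
  have t2_3 : 0 ≤ 2 * ((1 - β {0, 1, 2}) * β {3}) := mul_nonneg zero_le_two (mul_nonneg (c1 _) (h0 _))
  have t3_01 : 0 ≤ (1 / 2) * ((1 - β {0, 1}) * ((1 - β {2}) * β {3} + (1 - β {3}) * β {2})) :=
    mul_nonneg (by norm_num) (mul_nonneg (c1 _) (add_nonneg (mul_nonneg (c1 _) (h0 _)) (mul_nonneg (c1 _) (h0 _))))
  have t4_01 : 0 ≤ (1 / 2) * ((1 - β {0, 1}) * (1 + β {2, 3} - β {2} - β {3})) :=
    mul_nonneg (by norm_num) (mul_nonneg (c1 _) u23)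
  have t3_02 : 0 ≤ (1 / 2) * ((1 - β {0, 2}) * ((1 - β {1}) * β {3} + (1 - β {3}) * β {1})) :=
    mul_nonneg (by norm_num) (mul_nonneg (c1 _) (add_nonneg (mul_nonneg (c1 _) (h0 _)) (mul_nonneg (c1 _) (h0 _))))
  have t4_02 : 0 ≤ (1 / 2) * ((1 - β {0, 2}) * (1 + β {1, 3} - β {1} - β {3})) :=
    mul_nonneg (by norm_num) (mul_nonneg (c1 _) u13)
  have t3_03 : 0 ≤ (1 / 2) * ((1 - β {0, 3}) * ((1 - β {1}) * β {2} + (1 - β {2}) * β {1})) :=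
    mul_nonneg (by norm_num) (mul_nonneg (c1 _) (add_nonneg (mul_nonneg (c1 _) (h0 _)) (mul_nonneg (c1 _) (h0 _))))
  have t4_03 : 0 ≤ (1 / 2) * ((1 - β {0, 3}) * (1 + β {1, 2} - β {1} - β {2})) :=
    mul_nonneg (by norm_num) (mul_nonneg (c1 _) u12)
  have t3_12 : 0 ≤ (1 / 2) * ((1 - β {1, 2}) * ((1 - β {0}) * β {3} + (1 - β {3}) * β {0})) :=
    mul_nonneg (by norm_num) (mul_nonneg (c1 _) (add_nonneg (mul_nonneg (c1 _) (h0 _)) (mul_nonneg (c1 _) (h0 _))))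
  have t4_12 : 0 ≤ (1 / 2) * ((1 - β {1, 2}) * (1 + β {0, 3} - β {0} - β {3})) :=
    mul_nonneg (by norm_num) (mul_nonneg (c1 _) u03)
  have t3_13 : 0 ≤ (1 / 2) * ((1 - β {1, 3}) * ((1 - β {0}) * β {2} + (1 - β {2}) * β {0})) :=
    mul_nonneg (by norm_num) (mul_nonneg (c1 _) (add_nonneg (mul_nonneg (c1 _) (h0 _)) (mul_nonneg (c1 _) (h0 _))))
  have t4_13 : 0 ≤ (1 / 2) * ((1 - β {1, 3}) * (1 + β {0, 2} - β {0} - β {2})) :=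
    mul_nonneg (by norm_num) (mul_nonneg (c1 _) u02)
  have t3_23 : 0 ≤ (1 / 2) * ((1 - β {2, 3}) * ((1 - β {0}) * β {1} + (1 - β {1}) * β {0})) :=
    mul_nonneg (by norm_num) (mul_nonneg (c1 _) (add_nonneg (mul_nonneg (c1 _) (h0 _)) (mul_nonneg (c1 _) (h0 _))))
  have t4_23 : 0 ≤ (1 / 2) * ((1 - β {2, 3}) * (1 + β {0, 1} - β {0} - β {1})) :=
    mul_nonneg (by norm_num) (mul_nonneg (c1 _) u01)
  rw [phiSet_four_eq_cert β htop]
  linarith [t1_0, t1_1, t1_2, t1_3, t2_0, t2_1, t2_2, t2_3, t3_01, t4_01, t3_02, t4_02, t3_03, t4_03, t3_12, t4_12, t3_13,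
    t4_13, t3_23, t4_23]

/-- **`(UC-hull)_4` holds**: `Φ_4 ≥ 0` at every finite mixture of indicators of union-closed families containing `univ` — the mixture lies in the
box with top value one and satisfies every pairwise-union inequality (pointwise `[S ∈ 𝒰] + [T ∈ 𝒰] ≤ 1 + [S ∪ T ∈ 𝒰]` for union-closed `𝒰`). [this work] -/
theorem ucHullNonneg_four : GHConjecture.UCHullNonneg 4 := by
  intro α _ w 𝒰 hw0 hw1 hUC htop
  set β : Finset (Fin 4) → ℝ := fun S => ∑ x, w x * (if S ∈ 𝒰 x then (1 : ℝ) else 0) with hβ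
  have h0 : ∀ B, 0 ≤ β B := fun B => sum_nonneg fun x _ => mul_nonneg (hw0 x) (by split_ifs <;> norm_num)
  have h1 : ∀ B, β B ≤ 1 := fun B => by
    calc β B ≤ ∑ x, w x * 1 := sum_le_sum fun x _ => mul_le_mul_of_nonneg_left (by split_ifs <;> norm_num) (hw0 x)
      _ = 1 := by rw [← sum_mul, hw1, one_mul]
  have huniv : β univ = 1 := by
    have : ∀ x, w x * (if (univ : Finset (Fin 4)) ∈ 𝒰 x then (1 : ℝ) else 0) = w x := fun x => by rw [if_pos (htop x), mul_one]
    simp only [hβ, this, hw1]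
  have hu : ∀ S T : Finset (Fin 4), β S + β T ≤ 1 + β (S ∪ T) := by
    intro S T
    have hpt : ∀ x, w x * (if S ∈ 𝒰 x then (1 : ℝ) else 0) + w x * (if T ∈ 𝒰 x then (1 : ℝ) else 0) ≤
        w x * 1 + w x * (if S ∪ T ∈ 𝒰 x then (1 : ℝ) else 0) := by
      intro x
      rw [← mul_add, ← mul_add]
      refine mul_le_mul_of_nonneg_left ?_ (hw0 x)
      by_cases hS : S ∈ 𝒰 x
      · by_cases hT : T ∈ 𝒰 x
        · rw [if_pos hS, if_pos hT, if_pos (hUC x S hS T hT)]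
        · rw [if_pos hS, if_neg hT]; split_ifs <;> norm_num
      · rw [if_neg hS]; split_ifs <;> norm_num
    calc β S + β T = ∑ x, (w x * (if S ∈ 𝒰 x then (1 : ℝ) else 0) + w x * (if T ∈ 𝒰 x then (1 : ℝ) else 0)) := by
          rw [hβ, ← sum_add_distrib]
      _ ≤ ∑ x, (w x * 1 + w x * (if S ∪ T ∈ 𝒰 x then (1 : ℝ) else 0)) := sum_le_sum fun x _ => hpt x
      _ = 1 + β (S ∪ T) := by rw [sum_add_distrib, ← sum_mul, hw1, one_mul]
  exact phiSet_four_nonneg_of_pairUnion β h0 h1 huniv hu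

end UCHullFour

end Summit.CriticalPhenomena.PercolationContinuityZ3.Theorems
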